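import Literature.AlgebraicTopology.SingularHomology.CupSphereLadder
import Literature.AlgebraicTopology.SingularHomology.LerayHirschUnion
import Literature.AlgebraicTopology.SingularHomology.PuncturedEuclidean
import HarnessLib

/-!
# `ℝᴺ ∖ 0` (and the complement of `0` in a finite-dimensional real normed space) is a cup-sphere

A. Hatcher, *Algebraic Topology* (2002), §3.2 Thm. 3.16 / Example 3.11 (`H*(X × Sᵐ) ≅ H*(X) ⊗ H*(Sᵐ)`)
and §2.2 Ex. 2.18 / Cor. 2.14 (the computation of `Sᵐ` by the two-hemisphere Mayer–Vietoris
induction): we run the suspension ladder of `CupSphereLadder.lean` on the slit decomposition of the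
tree's `PuncturedEuclidean.lean` (`ℝᵏ⁺¹ ∖ 0 = slitUp ∪ slitDown`, both contractible, meeting in
`≃ ℝᵏ ∖ 0`):

* `exists_isCupSphere_punctured N`: **`ℝᴺ⁺¹ ∖ 0` is a cup-sphere of level `N`**, i.e. for every space
  `U` and ring `R`, `Hᵏ⁺ᴺ(U × (ℝᴺ⁺¹ ∖ 0)) = pr₁^* Hᵏ⁺ᴺ(U) ⊕ pr₂^* g ⌣ pr₁^* Hᵏ(U)` for a class
  `g ∈ Hᴺ(ℝᴺ⁺¹ ∖ 0; R)`, and `pr₁^*` is bijective below degree `N`;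
* `exists_isCupSphere_ne_zero`: the same for `{w ≠ 0}` in any finite-dimensional real normed space
  `W` of dimension `N + 1` (transport along a linear homeomorphism `W ≅ ℝᴺ⁺¹`).

(Universe `0`, where `ℝᴺ` lives.) Everything is proved; no named facts.

## References

* A. Hatcher, *Algebraic Topology*, CUP 2002, §3.2 Thm. 3.16, Example 3.11; §2.2 Example 2.18. [HatcherAT2002]
-/

noncomputable section

open CategoryTheory Function Set

namespace Literature.AlgebraicTopology.SingularHomology

variable (R : Type) [CommRing R]

/-! ### Level `0`: `ℝ ∖ 0` = two rays -/

/-- The negative ray of `ℝ¹ ∖ 0`. [folklore] -/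
def negRay : Set ↥(punctured 1) := {v | v.1 0 < 0}

/-- The positive ray of `ℝ¹ ∖ 0`. [folklore] -/
def posRay : Set ↥(punctured 1) := {v | 0 < v.1 0}

/-- The negative ray is open. [folklore] -/
theorem isOpen_negRay : IsOpen negRay :=
  isOpen_lt ((continuous_apply 0).comp continuous_subtype_val) continuous_const

/-- The positive ray is open. [folklore] -/
theorem isOpen_posRay : IsOpen posRay :=
  isOpen_lt continuous_const ((continuous_apply 0).comp continuous_subtype_val)

/-- The rays are disjoint. [folklore] -/
theorem disjoint_negRay_posRay : Disjoint negRay posRay :=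
  disjoint_left.2 fun v (hv : v.1 0 < 0) (hv' : 0 < v.1 0) ↦ lt_asymm hv hv'

/-- The rays cover `ℝ¹ ∖ 0`. [folklore] -/
theorem negRay_union_posRay : negRay ∪ posRay = univ := by
  refine eq_univ_of_forall fun v ↦ ?_
  have hv : v.1 0 ≠ 0 := fun h ↦ v.2 (funext fun i ↦ by rw [Fin.fin_one_eq_zero i, h]; rfl)
  rcases lt_or_gt_of_ne hv with h | h
  · exact Or.inl h
  · exact Or.inr h

/-- A ray `{v | 0 < s · v 0}` of `ℝ¹` (as a subset of `ℝ¹`), `s = ±1`, is convex. [folklore] -/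
theorem convex_ray (s : ℝ) : Convex ℝ {v : RVec 1 | 0 < s * v 0} := by
  intro v hv w hw a b ha hb hab
  change 0 < s * (a • v + b • w) 0
  simp only [Pi.add_apply, Pi.smul_apply, smul_eq_mul]
  have hv' : 0 < s * v 0 := hv
  have hw' : 0 < s * w 0 := hw
  rcases ha.eq_or_lt with rfl | ha'
  · rw [zero_add] at hab; subst hab; simpa using hw'
  · nlinarith [mul_nonneg hb hw'.le]

/-- The rays are contractible. [folklore] -/
theorem contractibleSpace_ray {P : Set ↥(punctured 1)} (s : ℝ) (hP : ∀ v : ↥(punctured 1), v ∈ P ↔ 0 < s * v.1 0)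
    (hne : P.Nonempty) : ContractibleSpace ↥P := by
  have hsub : {v : RVec 1 | 0 < s * v 0} ⊆ punctured 1 := fun v (hv : 0 < s * v 0) h ↦ by
    rw [h] at hv; simp at hv
  have hP' : (Subtype.val ⁻¹' {v : RVec 1 | 0 < s * v 0} : Set ↥(punctured 1)) = P := Set.ext fun v ↦ (hP v).symm
  haveI : ContractibleSpace ↥({v : RVec 1 | 0 < s * v 0}) :=
    (convex_ray s).contractibleSpace (by obtain ⟨v, hv⟩ := hne; exact ⟨v.1, (hP v).1 hv⟩)
  exact ((inclHomeomorph (W := punctured 1) hsub).trans (Homeomorph.setCongr hP')).contractibleSpace_iff.1 inferInstance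

/-- The point `1 ∈ ℝ¹ ∖ 0`. [folklore] -/
def onePt : ↥(punctured 1) := ⟨fun _ ↦ 1, fun h ↦ by simpa using congrFun h 0⟩

/-- **`ℝ¹ ∖ 0` is a cup-sphere of level `0`.** [cite: HatcherAT2002, §3.2 Example 3.11] -/
theorem exists_isCupSphere_punctured_one : ∃ g : singularCohomology R R ↥(punctured 1) 0, IsCupSphere R ↥(punctured 1) 0 g := by
  haveI : ContractibleSpace ↥negRay := contractibleSpace_ray (-1) (fun v ↦ by simp [negRay])
    ⟨⟨fun _ ↦ -1, fun h ↦ by simpa using congrFun h 0⟩, by simp [negRay]⟩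
  haveI : ContractibleSpace ↥posRay := contractibleSpace_ray 1 (fun v ↦ by simp [posRay]) ⟨onePt, by simp [posRay, onePt]⟩
  obtain ⟨g, hg₁, hg₂⟩ := exists_indicatorClass R isOpen_negRay isOpen_posRay disjoint_negRay_posRay negRay_union_posRay
  exact ⟨g, isCupSphere_zero R isOpen_negRay isOpen_posRay disjoint_negRay_posRay negRay_union_posRay g hg₁ hg₂⟩

/-! ### The suspension: `ℝᵏ⁺² ∖ 0` from `ℝᵏ⁺¹ ∖ 0` -/

section Step

variable (k : ℕ)

/-- `slitUp ⊆ ℝᵏ⁺¹ ∖ 0`. [folklore] -/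
theorem slitUp_subset_punctured : slitUp k ⊆ punctured (k + 1) := by
  rw [← slitUp_union_slitDown]; exact subset_union_left

/-- `slitDown ⊆ ℝᵏ⁺¹ ∖ 0`. [folklore] -/
theorem slitDown_subset_punctured : slitDown k ⊆ punctured (k + 1) := by
  rw [← slitUp_union_slitDown]; exact subset_union_right

/-- The upper slit set read inside `ℝᵏ⁺¹ ∖ 0`. [folklore] -/
def slitUp' : Set ↥(punctured (k + 1)) := Subtype.val ⁻¹' slitUp k

/-- The lower slit set read inside `ℝᵏ⁺¹ ∖ 0`. [folklore] -/
def slitDown' : Set ↥(punctured (k + 1)) := Subtype.val ⁻¹' slitDown k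

/-- It is open. [folklore] -/
theorem isOpen_slitUp' : IsOpen (slitUp' k) := (isOpen_slitUp k).preimage continuous_subtype_val

/-- It is open. [folklore] -/
theorem isOpen_slitDown' : IsOpen (slitDown' k) := (isOpen_slitDown k).preimage continuous_subtype_val

/-- They cover. [folklore] -/
theorem slitUp'_union_slitDown' : slitUp' k ∪ slitDown' k = univ := by
  refine eq_univ_of_forall fun v ↦ ?_
  have : v.1 ∈ slitUp k ∪ slitDown k := by rw [slitUp_union_slitDown]; exact v.2
  exact this

/-- The slit pieces are contractible. [folklore] -/
instance contractibleSpace_slitUp' : ContractibleSpace ↥(slitUp' k) := by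
  haveI := contractibleSpace_slitUp k
  exact (inclHomeomorph (W := punctured (k + 1)) (slitUp_subset_punctured k)).contractibleSpace_iff.1 inferInstance

/-- The slit pieces are contractible. [folklore] -/
instance contractibleSpace_slitDown' : ContractibleSpace ↥(slitDown' k) := by
  haveI := contractibleSpace_slitDown k
  exact (inclHomeomorph (W := punctured (k + 1)) (slitDown_subset_punctured k)).contractibleSpace_iff.1 inferInstance

/-- The overlap of the slit pieces, read inside `ℝᵏ⁺¹ ∖ 0`, is the double slit set. [folklore] -/
def slitInterHomeomorph' : ↥(slitUp' k ∩ slitDown' k) ≃ₜ ↥(slitUp k ∩ slitDown k) :=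
  (inclHomeomorph (W := punctured (k + 1)) (S := slitUp k ∩ slitDown k)
    (inter_subset_left.trans (slitUp_subset_punctured k))).symm

/-- A point of the overlap (in dimension `≥ 2`): `(1, …, 1)`. [folklore] -/
theorem ones_mem_inter :
    (⟨fun _ ↦ 1, fun h ↦ by simpa using congrFun h 0⟩ : ↥(punctured (k + 2))) ∈ slitUp' (k + 1) ∩ slitDown' (k + 1) := by
  change (fun _ ↦ (1 : ℝ)) ∈ slitUp (k + 1) ∩ slitDown (k + 1)
  rw [mem_slitInter_iff]
  intro h
  have := congrFun h 0
  simp [Fin.init] at this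

end Step

/-- **`ℝᴺ⁺¹ ∖ 0` is a cup-sphere of level `N`** (for a suitable class `g ∈ Hᴺ(ℝᴺ⁺¹ ∖ 0; R)`):
`H*(U × (ℝᴺ⁺¹ ∖ 0)) = pr₁^* H*(U) ⊕ pr₂^* g ⌣ pr₁^* H*⁻ᴺ(U)` for every space `U`.
[cite: HatcherAT2002, §3.2 Thm. 3.16, Example 3.11] -/
theorem exists_isCupSphere_punctured : ∀ N : ℕ, ∃ g : singularCohomology R R ↥(punctured (N + 1)) N,
    IsCupSphere R ↥(punctured (N + 1)) N g
  | 0 => exists_isCupSphere_punctured_one R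
  | N + 1 => by
    obtain ⟨g, hg⟩ := exists_isCupSphere_punctured N
    -- `ℝᴺ⁺¹ ∖ 0 ≃ₕ` double slit set `≅` the overlap of the slit pieces of `ℝᴺ⁺² ∖ 0`
    have h1 := hg.of_homotopyEquiv (slitInterHomotopyEquiv (N + 1))
    have h2 := h1.of_homeomorph (slitInterHomeomorph' (N + 1))
    exact ⟨_, h2.suspension R (isOpen_slitUp' (N + 1)) (isOpen_slitDown' (N + 1)) (slitUp'_union_slitDown' (N + 1))
      (ones_mem_inter N)⟩

/-! ### Finite-dimensional real normed spaces -/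

/-- **`{w ≠ 0}` in a real normed space of dimension `N + 1` is a cup-sphere of level `N`.**
[cite: HatcherAT2002, §3.2 Thm. 3.16, Example 3.11] -/
theorem exists_isCupSphere_ne_zero (W : Type) [NormedAddCommGroup W] [NormedSpace ℝ W] [FiniteDimensional ℝ W] {N : ℕ}
    (hW : Module.finrank ℝ W = N + 1) :
    ∃ g : singularCohomology R R {w : W // w ≠ 0} N, IsCupSphere R {w : W // w ≠ 0} N g := by
  obtain ⟨g, hg⟩ := exists_isCupSphere_punctured R N
  let L : W ≃L[ℝ] RVec (N + 1) := ContinuousLinearEquiv.ofFinrankEq (by rw [hW, Module.finrank_fin_fun])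
  let e : {w : W // w ≠ 0} ≃ₜ ↥(punctured (N + 1)) := L.toHomeomorph.subtype fun w ↦ by
    change w ≠ 0 ↔ L w ∈ punctured (N + 1)
    rw [mem_punctured, L.toLinearEquiv.map_ne_zero_iff.symm]
    rfl
  exact ⟨_, hg.of_homeomorph e⟩

end Literature.AlgebraicTopology.SingularHomology
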